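import Summits.BirchSwinnertonDyer.BirchSwinnertonDyer.Theorems.KolyvaginRankRigidityAtTwoRegularRefillHybridStructure
import Summits.BirchSwinnertonDyer.BirchSwinnertonDyer.Theorems.KolyvaginRankRigidityAtTwoRegularEigenLinesAtTwo
import HarnessLib

/-!
# Crux U1 `KolyvaginBoundedDefectAtTwo` (stmt-BirchSwinnertonDyer-28083), LINE 17 `regular_core_rigidity` v3,
# stub S1b `stub_nearCoreExistenceAtTwo` — the REFILL LAW AT A REGULAR PURE-SIGN STEP, assembled: the co-cyclicity
# hypothesis discharged by the regular eigen-lines, leaving only the engine's output as hypothesis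

Width seat `bsd-line-krr2-p2` g13 (ONE READER on S1b); `--supports stmt-BirchSwinnertonDyer-28083` (helper). THEOREMS
ONLY; nothing here proves S1b, U1, a rung or BSD. BSD is NOT proved.

## What

`𝓛 = 𝓕(c) = selmerF W 2^k 𝒯 (placesDividing K c)`, `v ∣ ℓ ∣ c` a place of the square-free Kolyvagin conductor
(indices `≥ k + 1`), `ℓ` REGULAR at level `2^k` (the body of LINE 17's `IsRegularPrimeAt W k ℓ`), `τ • v = v`. The walk
supplies (Čebotarev engine `exists_regular_kolyvaginPrime_of_heegner`) a global class `z` in the previous vertex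
`H¹_{𝓛[v ↦ Kum_v]}` which is a `τ`-eigenclass (`τ_* z = s•z`) and whose localisation at `v` has exact order `2^k`. THEN:
* `eigenline_le_of_eigenclass` — the whole `s`-eigen-line `Kum_v ∩ ker(σ_* − s)` lies in `X ∩ Kum_v`,
  `X = loc_v(H¹_{𝓛[v ↦ ⊤]})` (`loc_v z` lies in the line by `conjActPlace_localization` and generates it: the line is
  cyclic of order `2^k`, `kummer_regular_eigen_at_two` (a), p677251);
* `hcyc_of_eigenclass` — hence `Kum_v = (X ∩ Kum_v) + ℤe₀` (co-cyclicity (b) of p677251);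
* **`two_nsmul_mem_of_regular_eigenclass`**, **`lozenge_refill_of_regular_eigenclass`** — the refill law and its walk
  form (p674377) with `hcyc` DISCHARGED: `2 · ann_{𝒯_v}(X ∩ Kum_v) ⊆ X` and
  `#H¹_{𝓛[v ↦ Kum_v]} · #Kum_v ≤ 2 · #loc_v(H¹_{𝓛[v ↦ Kum_v]})² · #H¹_{𝓛}`.
Remaining hypotheses: the frame (`K` imaginary quadratic, `d_K < −4`, Weil datum, PT family `inv` — all with canonical
models in the tree) and the ENGINE OUTPUT (`z`, `s`, the order of `loc_v z`). This is the per-step input of the walk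
(N4) of the reader reports `S1-READER-g13*.md`. References (locators only; no cited FACT is declared):
[cite: MazurRubin2004, §2.4 (H.2), Prop. 1.3.2, Thm. 2.3.4, §4.1] [cite: Jetchev2008, §3.2 (2), Lemma 5.2, §5.2]
[cite: Howard2004HeegnerKolyvagin, Thm. 2.1.11] [cite: GrossLMS1991, §3 (3.1)–(3.4)].
Design: no definitions; `K : Type`; axioms `propext`, `Classical.choice`, `Quot.sound`.
-/

set_option autoImplicit false
-- the Theorems namespace of this sub repeats the summit name by design (D-0017 nested layout)
set_option linter.dupNamespace false

noncomputable section

open scoped Classical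
open Function NumberField IsDedekindDomain WeierstrassCurve Field
open Literature.NumberTheory.EllipticCurves Literature.NumberTheory.EllipticCurves.Jetchev2008
open Literature.NumberTheory.GaloisRepresentations Literature.NumberTheory.GaloisCohomology
open Literature.NumberTheory.GaloisRepresentations.DiscreteGaloisModule (localTatePairingZMod tateDual
  transverseSubgroup SelmerStructure)
open Literature.NumberTheory.Automorphic
open Summit.BirchSwinnertonDyer.Rank1Residual
open Summit.BirchSwinnertonDyer.Rank1Residual.JET.RingClassTransverse
open Summit.BirchSwinnertonDyer.Rank1Residual.JET.SelmerVocabulary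
open Summit.BirchSwinnertonDyer.Rank1Residual.X11b.Relaxation (invWeilPairing invWeilPairing_apply
  invWeilPairing_eq_zero_of_mem)
open Summit.BirchSwinnertonDyer.BirchSwinnertonDyer.Theorems.KolyvaginLowerBoundAtTwo

namespace Summit.BirchSwinnertonDyer.BirchSwinnertonDyer.Theorems.KolyvaginAtTwo.RegularRefill

variable {K : Type} [Field K] [NumberField K] (W : WeierstrassCurve ℚ) [W.IsElliptic] [W.IsGloballyMinimal]
  (k : ℕ)
  (e : geomTorsion (W.baseChange K) ((2 ^ k : ℕ) : ℤ) → geomTorsion (W.baseChange K) ((2 ^ k : ℕ) : ℤ) →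
    AlgebraicClosure K)
  (hμ : ∀ S T, e S T ^ (2 ^ k) = 1)
  (hadd₁ : ∀ S₁ S₂ T, e (S₁ + S₂) T = e S₁ T * e S₂ T)
  (hadd₂ : ∀ S T₁ T₂, e S (T₁ + T₂) = e S T₁ * e S T₂)
  (hgal : ∀ (g : absoluteGaloisGroup K) (S T : geomTorsion (W.baseChange K) ((2 ^ k : ℕ) : ℤ)),
    g • e S T = e (g • S) (g • T))
  (halt : ∀ T, e T T = 1) (hnondeg : ∀ T, (∀ S, e S T = 1) → T = 0)
  (inv : LocalInvariants K (2 ^ k))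
  (hK : IsImaginaryQuadratic K) (hD : NumberField.discr K < -4) (ι : K →+* ℂ)
  [∀ j : ℕ, NumberField (ringClassField K ι j)] (hk : 1 ≤ k)
  (c : ℕ) (hc : Squarefree c)
  (hkol : ∀ ℓ ∈ c.primeFactors, Zhang2014.IsKolyvaginPrime (W.conductorNorm ℤ) W K 2 ℓ)
  (hkM : ∀ ℓ ∈ c.primeFactors, k + 1 ≤ Zhang2014.kolyvaginIndex W 2 ℓ)
  (𝒯 : SelmerStructure ((W.baseChange K).torsionGaloisModule ((2 ^ k : ℕ) : ℤ)))
  (h𝒯 : ∀ v : HeightOneSpectrum (𝓞 K), 𝒯 (Sum.inr v) =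
    ⨅ ℓ ∈ c.primeFactors.filter (fun ℓ : ℕ ↦ ((ℓ : ℕ) : 𝓞 K) ∈ v.asIdeal),
      ⨅ (w' : HeightOneSpectrum (𝓞 (ringClassField K ι ℓ))) (_ : w'.asIdeal.LiesOver v.asIdeal),
        letI := (adicCompletionOfLiesOver K (ringClassField K ι ℓ) v w').toAlgebra
        transverseSubgroup (GaloisRep.toLocal v ((W.baseChange K).torsionGaloisModule ((2 ^ k : ℕ) : ℤ)))
          (w'.adicCompletion (ringClassField K ι ℓ)))
  (hperf : inv.IsPerfect) (hvan : inv.SumLocalTermEqZero) (hcomp : inv.SelmerComplement)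
  -- the regular place and the eigenclass supplied by the engine
  {ℓ : ℕ} (hℓc : ℓ ∈ c.primeFactors)
  (hreg : ∃ (v₁ : HeightOneSpectrum (𝓞 ℚ)) (𝔓₁ : Ideal (absIntegers (𝓞 ℚ) ℚ)) (h : absoluteGaloisGroup ℚ),
    (ℓ : 𝓞 ℚ) ∈ v₁.asIdeal ∧ 𝔓₁ ∈ v₁.primesAbove ∧ IsArithFrobAt (𝓞 ℚ) h 𝔓₁ ∧
    (∀ X : geomTorsion W ((2 ^ k : ℕ) : ℤ), h • h • X = X) ∧
    ∃ P : geomTorsion W ((2 ^ k : ℕ) : ℤ), (2 : ℤ) ^ (k - 1) • (P + h • P) ≠ 0)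
  (v : HeightOneSpectrum (𝓞 K)) (hv : (ℓ : 𝓞 K) ∈ v.asIdeal)
  {τ : K ≃ₐ[ℚ] K} (hτ1 : τ ≠ 1) (hfix : τ • v = v) {s : ℤ} (hs : s = 1 ∨ s = -1)
  {z : galoisCohomology ((W.baseChange K).torsionGaloisModule ((2 ^ k : ℕ) : ℤ)) 1}
  (hz : z ∈ SelmerStructure.selmerGroup (Function.update (selmerF W ((2 ^ k : ℕ) : ℤ) 𝒯 (placesDividing K c))
    (Sum.inr v : Place K) ((W.baseChange K).kummerSelmerStructure ((2 ^ k : ℕ) : ℤ) (Sum.inr v : Place K)) :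
    SelmerStructure ((W.baseChange K).torsionGaloisModule ((2 ^ k : ℕ) : ℤ))))
  (hzτ : conjAct W τ ((2 ^ k : ℕ) : ℤ) z = s • z)
  (hzord : addOrderOf (galoisCohomology.localization ((W.baseChange K).torsionGaloisModule ((2 ^ k : ℕ) : ℤ))
    (Sum.inr v : Place K) 1 z) = 2 ^ k)

/-- The place of a prime factor of `c` divides `c`. [folklore] -/
theorem mem_placesDividing_of_mem_primeFactors {c ℓ : ℕ} (hc : Squarefree c) (hℓc : ℓ ∈ c.primeFactors)
    (v : HeightOneSpectrum (𝓞 K)) (hv : (ℓ : 𝓞 K) ∈ v.asIdeal) : v ∈ placesDividing K c :=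
  (mem_placesDividing_iff_natCast_mem hc.ne_zero v).mpr
    ((natCast_mem_iff_exists_primeFactor_mem hc.ne_zero v).mpr ⟨ℓ, hℓc, hv⟩)

include hK hk hkol hkM hℓc hreg hv hτ1 hs hz hzτ hzord in
/-- **The eigen-line of the engine's class lies in the cut.** With `X = loc_v(H¹_{𝓛[v ↦ ⊤]})`: the `s`-eigen-line
`Kum_v ∩ ker(σ_* − s)` is contained in `X ∩ Kum_v` — `loc_v z` is in `X ∩ Kum_v` (`z` lies in the previous vertex), in
the eigen-line (`conjActPlace_localization`), and generates it (cyclic of order `2^k`, `kummer_regular_eigen_at_two`).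
[cite: MazurRubin2004, §2.4 (H.2)] [cite: Jetchev2008, §3.2 (2), §5 Thm. 5.1] -/
theorem eigenline_le_of_eigenclass :
    (W.baseChange K).kummerSelmerStructure ((2 ^ k : ℕ) : ℤ) (Sum.inr v) ⊓
        (conjActPlace W τ ((2 ^ k : ℕ) : ℤ) hfix - s • AddMonoidHom.id _).ker ≤
      (SelmerStructure.selmerGroup (Function.update (selmerF W ((2 ^ k : ℕ) : ℤ) 𝒯 (placesDividing K c))
          (Sum.inr v : Place K) ⊤ : SelmerStructure ((W.baseChange K).torsionGaloisModule ((2 ^ k : ℕ) : ℤ)))).map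
        (galoisCohomology.localization ((W.baseChange K).torsionGaloisModule ((2 ^ k : ℕ) : ℤ)) (Sum.inr v : Place K) 1) ⊓
      (W.baseChange K).kummerSelmerStructure ((2 ^ k : ℕ) : ℤ) (Sum.inr v : Place K) := by
  have hℓ := hkol ℓ hℓc
  have hkℓ : k ≤ Zhang2014.kolyvaginIndex W 2 ℓ := Nat.le_of_succ_le (hkM ℓ hℓc)
  obtain ⟨⟨cs, hcsK, hcsord, hline⟩, -⟩ :=
    kummer_regular_eigen_at_two W K hK hk hℓ hkℓ hreg v hv hτ1 hfix hs
  set loc := galoisCohomology.localization ((W.baseChange K).torsionGaloisModule ((2 ^ k : ℕ) : ℤ))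
    (Sum.inr v : Place K) 1 with hloc
  -- `loc z ∈ X ∩ Kum_v`
  have hz' := hz
  rw [selmerGroup_update_eq_inf_comap W k _ v] at hz'
  obtain ⟨hzRel, hzKum⟩ := AddSubgroup.mem_inf.mp hz'
  have hzKum' : loc z ∈ (W.baseChange K).kummerSelmerStructure ((2 ^ k : ℕ) : ℤ) (Sum.inr v : Place K) :=
    AddSubgroup.mem_comap.mp hzKum
  -- `loc z` is in the eigen-line
  have hzeig : loc z ∈ (W.baseChange K).kummerSelmerStructure ((2 ^ k : ℕ) : ℤ) (Sum.inr v) ⊓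
      (conjActPlace W τ ((2 ^ k : ℕ) : ℤ) hfix - s • AddMonoidHom.id _).ker := by
    refine AddSubgroup.mem_inf.mpr ⟨hzKum', (AddMonoidHom.mem_ker).mpr ?_⟩
    rw [AddMonoidHom.sub_apply, AddMonoidHom.smul_apply, AddMonoidHom.id_apply, sub_eq_zero, hloc,
      conjActPlace_localization, hzτ, map_zsmul]
  -- hence the eigen-line is `ℤ (loc z)`
  obtain ⟨m, hm⟩ := AddSubgroup.mem_zmultiples_iff.mp ((hline _).mp hzeig)
  have hle : AddSubgroup.zmultiples (loc z) ≤ AddSubgroup.zmultiples cs := by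
    rw [AddSubgroup.zmultiples_le, ← hm]
    exact AddSubgroup.zsmul_mem _ (AddSubgroup.mem_zmultiples cs) m
  haveI : Finite (AddSubgroup.zmultiples cs) := by
    apply Nat.finite_of_card_ne_zero
    rw [Nat.card_zmultiples, hcsord]; positivity
  have heq : AddSubgroup.zmultiples (loc z) = AddSubgroup.zmultiples cs :=
    AddSubgroup.eq_of_le_of_card_ge hle (by rw [Nat.card_zmultiples, Nat.card_zmultiples, hcsord, hzord])
  -- conclude
  have hzX : loc z ∈ (SelmerStructure.selmerGroup (Function.update (selmerF W ((2 ^ k : ℕ) : ℤ) 𝒯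
      (placesDividing K c)) (Sum.inr v : Place K) ⊤ :
        SelmerStructure ((W.baseChange K).torsionGaloisModule ((2 ^ k : ℕ) : ℤ)))).map loc :=
    AddSubgroup.mem_map.mpr ⟨z, hzRel, rfl⟩
  intro y hy
  have hy' : y ∈ AddSubgroup.zmultiples (loc z) := by rw [heq]; exact (hline y).mp hy
  obtain ⟨j, rfl⟩ := AddSubgroup.mem_zmultiples_iff.mp hy'
  exact AddSubgroup.mem_inf.mpr ⟨AddSubgroup.zsmul_mem _ hzX j, AddSubgroup.zsmul_mem _ hzKum' j⟩

include hK hk hkol hkM hℓc hreg hv hτ1 hfix hs hz hzτ hzord in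
/-- **Co-cyclicity of the cut from an eigenclass** — hypothesis `hcyc` of the refill law: `Kum_v = (X ∩ Kum_v) + ℤe₀`.
[cite: MazurRubin2004, §2.4 (H.2)] [cite: GrossLMS1991, §3 (3.3)] -/
theorem hcyc_of_eigenclass :
    ∃ e₀ ∈ (W.baseChange K).kummerSelmerStructure ((2 ^ k : ℕ) : ℤ) (Sum.inr v : Place K),
      ∀ f ∈ (W.baseChange K).kummerSelmerStructure ((2 ^ k : ℕ) : ℤ) (Sum.inr v : Place K), ∃ m : ℤ,
        f - m • e₀ ∈ (SelmerStructure.selmerGroup (Function.update (selmerF W ((2 ^ k : ℕ) : ℤ) 𝒯 (placesDividing K c))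
            (Sum.inr v : Place K) ⊤ : SelmerStructure ((W.baseChange K).torsionGaloisModule ((2 ^ k : ℕ) : ℤ)))).map
          (galoisCohomology.localization ((W.baseChange K).torsionGaloisModule ((2 ^ k : ℕ) : ℤ))
            (Sum.inr v : Place K) 1) := by
  have hℓ := hkol ℓ hℓc
  have hkℓ : k ≤ Zhang2014.kolyvaginIndex W 2 ℓ := Nat.le_of_succ_le (hkM ℓ hℓc)
  obtain ⟨-, e₀, he₀, hco⟩ := kummer_regular_eigen_at_two W K hK hk hℓ hkℓ hreg v hv hτ1 hfix hs
  have hle := eigenline_le_of_eigenclass W k hK hk c hkol hkM 𝒯 hℓc hreg v hv hτ1 hfix hs hz hzτ hzord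
  refine ⟨e₀, he₀, fun f hf ↦ ?_⟩
  obtain ⟨m, hm⟩ := hco f hf
  exact ⟨m, (AddSubgroup.mem_inf.mp (hle hm)).1⟩

include hK hD hk hc hkol hkM h𝒯 halt hnondeg hperf hvan hcomp hℓc hreg hv hτ1 hfix hs hz hzτ hzord in
/-- **THE REFILL LAW AT A REGULAR PURE-SIGN STEP (co-cyclicity discharged).** Frame + regular place `v ∣ ℓ ∣ c` + an
eigenclass `z ∈ H¹_{𝓛[v ↦ Kum_v]}` with `τ_* z = s•z` and `loc_v z` of order `2^k` (the engine's output) ⟹ every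
`t ∈ 𝒯_v` annihilating `X ∩ Kum_v` has `2t ∈ X = loc_v(H¹_{𝓛[v ↦ ⊤]})`.
[cite: MazurRubin2004, Prop. 1.3.2, Thm. 2.3.4, §4.1] [cite: Howard2004HeegnerKolyvagin, Thm. 2.1.11] -/
theorem two_nsmul_mem_of_regular_eigenclass [NeZero (2 ^ k)] [Finite (geomTorsion (W.baseChange K) ((2 ^ k : ℕ) : ℤ))]
    {t : galoisCohomology ((((W.baseChange K).torsionGaloisModule ((2 ^ k : ℕ) : ℤ))).toLocal (Sum.inr v : Place K)) 1}
    (ht : t ∈ 𝒯 (Sum.inr v))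
    (hann : ∀ a ∈ (SelmerStructure.selmerGroup (Function.update (selmerF W ((2 ^ k : ℕ) : ℤ) 𝒯 (placesDividing K c))
          (Sum.inr v : Place K) ⊤ : SelmerStructure ((W.baseChange K).torsionGaloisModule ((2 ^ k : ℕ) : ℤ)))).map
        (galoisCohomology.localization ((W.baseChange K).torsionGaloisModule ((2 ^ k : ℕ) : ℤ)) (Sum.inr v : Place K) 1) ⊓
        (W.baseChange K).kummerSelmerStructure ((2 ^ k : ℕ) : ℤ) (Sum.inr v : Place K),
      invWeilPairing (W.baseChange K) (2 ^ k) e hμ hadd₁ hadd₂ hgal inv (Sum.inr v) a t = 0) :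
    2 • t ∈ (SelmerStructure.selmerGroup (Function.update (selmerF W ((2 ^ k : ℕ) : ℤ) 𝒯 (placesDividing K c))
          (Sum.inr v : Place K) ⊤ : SelmerStructure ((W.baseChange K).torsionGaloisModule ((2 ^ k : ℕ) : ℤ)))).map
        (galoisCohomology.localization ((W.baseChange K).torsionGaloisModule ((2 ^ k : ℕ) : ℤ)) (Sum.inr v : Place K) 1) := by
  obtain ⟨e₀, he₀, hcyc⟩ := hcyc_of_eigenclass W k hK hk c hkol hkM 𝒯 hℓc hreg v hv hτ1 hfix hs hz hzτ hzord
  exact two_nsmul_mem_map_localization_relaxed_selmerF W k e hμ hadd₁ hadd₂ hgal halt hnondeg inv hK hD ι hk c hc hkol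
    hkM 𝒯 h𝒯 hperf hvan hcomp v (mem_placesDividing_of_mem_primeFactors hc hℓc v hv) he₀ hcyc ht hann

include hμ hadd₁ hadd₂ hgal hK hD hk hc hkol hkM h𝒯 halt hnondeg hperf hvan hcomp hℓc hreg hv hτ1 hfix hs hz hzτ hzord in
/-- **WALK FORM AT A REGULAR PURE-SIGN STEP (co-cyclicity discharged):**
`#H¹_{𝓛[v ↦ Kum_v]} · #Kum_v ≤ 2 · #loc_v(H¹_{𝓛[v ↦ Kum_v]})² · #H¹_{𝓛}` — with `#Kum_v = 2^(2k)` and a pure-sign image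
`#loc_v(H¹_{𝓛[v ↦ Kum_v]}) = 2^k`, the new vertex `H¹_{𝓕(c)}` has at least half the size of `H¹_{𝓕(c)[v ↦ Kum_v]}`.
[cite: MazurRubin2004, Prop. 1.3.2, §4.1] [cite: Jetchev2008, Lemma 5.2, proof of Prop. 5.3] -/
theorem lozenge_refill_of_regular_eigenclass [NeZero (2 ^ k)]
    [Finite (geomTorsion (W.baseChange K) ((2 ^ k : ℕ) : ℤ))] :
    Nat.card (SelmerStructure.selmerGroup (Function.update (selmerF W ((2 ^ k : ℕ) : ℤ) 𝒯 (placesDividing K c))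
          (Sum.inr v : Place K) ((W.baseChange K).kummerSelmerStructure ((2 ^ k : ℕ) : ℤ) (Sum.inr v : Place K)) :
          SelmerStructure ((W.baseChange K).torsionGaloisModule ((2 ^ k : ℕ) : ℤ)))) *
        Nat.card ((W.baseChange K).kummerSelmerStructure ((2 ^ k : ℕ) : ℤ) (Sum.inr v : Place K)) ≤
      2 * Nat.card ((SelmerStructure.selmerGroup (Function.update (selmerF W ((2 ^ k : ℕ) : ℤ) 𝒯 (placesDividing K c))
            (Sum.inr v : Place K) ((W.baseChange K).kummerSelmerStructure ((2 ^ k : ℕ) : ℤ) (Sum.inr v : Place K)) :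
            SelmerStructure ((W.baseChange K).torsionGaloisModule ((2 ^ k : ℕ) : ℤ)))).map
          (galoisCohomology.localization ((W.baseChange K).torsionGaloisModule ((2 ^ k : ℕ) : ℤ))
            (Sum.inr v : Place K) 1)) ^ 2 *
        Nat.card (selmerF W ((2 ^ k : ℕ) : ℤ) 𝒯 (placesDividing K c)).selmerGroup := by
  obtain ⟨e₀, he₀, hcyc⟩ := hcyc_of_eigenclass W k hK hk c hkol hkM 𝒯 hℓc hreg v hv hτ1 hfix hs hz hzτ hzord
  exact lozenge_refill_selmerF W k e hμ hadd₁ hadd₂ hgal halt hnondeg inv hK hD ι hk c hc hkol hkM 𝒯 h𝒯 hperf hvan hcomp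
    v (mem_placesDividing_of_mem_primeFactors hc hℓc v hv) he₀ hcyc

end Summit.BirchSwinnertonDyer.BirchSwinnertonDyer.Theorems.KolyvaginAtTwo.RegularRefill

end
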